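import Literature.NumberTheory.Automorphic.KimExteriorSquareGL4
import HarnessLib

/-!
# Kim's exterior square `GL₄ → GL₆`: companion lemmas (all proved, no new fact)

Topic `Literature/NumberTheory/Automorphic`; companions to the named fact
`Kim2003_exteriorSquare_GL4` and the operation `wedgeTwoParams` of `KimExteriorSquareGL4.lean`
(Kim, J. Amer. Math. Soc. 16 (2003), Thm. A p. 139 = Thm. 5.3.1 p. 165 [`Kim2002`]), filed as
the debt-`0` follow-up suggested in the review of p41450 (work item `wi-12123`, route item
`WedgeSquareDescent` = `stmt-Langlands-3799` of `K3KugaSatakeDescent`):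

* `wedgeTwoParams_four` — the `n = 4 ↦ 6` expansion `∧²{a,b,c,d} = {ad, ac, bd, cd, bc, ab}`;
* `wedgeTwoParams_map_mul` — scaling/twisting compatibility `∧²(c • α) = c² • ∧²α` (the `|det|^s`
  reduction recorded in the module docstring of `KimExteriorSquareGL4.lean`);
* `Kim2003_exteriorSquare_GL4.hasSatakeParamAt_of_decomposition_one` — **a one-term isobaric
  decomposition is a cuspidal exterior square**: if the isobaric clause of the fact holds for `π`
  with a single cuspidal `σ` on `GL₆` (`k = 1`), then `σ` carries the parameters `∧² t_{π,v}` at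
  almost every `v` (inputs: uniqueness of Satake parameters `hasSatakeParamAt_unique` and
  unramifiedness a.e. `hasSatakeParamAt_cofinite`, both named facts of `AutomorphicRepsGL.lean`
  proved for every datum in `AutomorphicRepsGLSatakeFlathProofs.lean` as `…_holds`, taken here
  as hypotheses to keep the imports light) — the form in which a CUSPIDAL `∧²π` is consumed,
  e.g. by `cuspidal_descent_cyclic`;
* `isobaricClause_one_iff` — the `Fin 1` bookkeeping turning the fact's clause into the one-term
  hypothesis of the previous lemma.
-/

noncomputable section

open scoped Classical
open NumberField IsDedekindDomain Filter

namespace Literature.NumberTheory.Automorphic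

/-! ### More on `wedgeTwoParams` -/

/-- The case `n = 4 ↦ 6`: `∧²{a, b, c, d} = {ad, ac, bd, cd, bc, ab}` (as multisets the order is
immaterial) — the six Satake parameters `{αᵢαⱼ}_{i<j}` of `∧²π_v`. [cite: Kim2002, §1 (Introduction)] -/
theorem wedgeTwoParams_four (a b c d : ℂ) :
    wedgeTwoParams ({a, b, c, d} : Multiset ℂ) = {a * d, a * c, b * d, c * d, b * c, a * b} := by
  simp [wedgeTwoParams, Multiset.powersetCard_cons, Multiset.powersetCard_one]

/-- **Scaling (twisting) compatibility**: `∧²(c • α) = c² • ∧²α`, i.e. twisting `π` by a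
character with value `c` at `ϖ_v` twists `∧²π` by its square (used for the `|det|^s` reduction
from arbitrary to unitary central character). [folklore] -/
theorem wedgeTwoParams_map_mul (c : ℂ) (α : Multiset ℂ) :
    wedgeTwoParams (α.map (c * ·)) = (wedgeTwoParams α).map (c ^ 2 * ·) := by
  rw [wedgeTwoParams, wedgeTwoParams, Multiset.powersetCard_map, Multiset.map_map,
    Multiset.map_map]
  refine Multiset.map_congr rfl fun t ht ↦ ?_
  have hcard : Multiset.card t = 2 := (Multiset.mem_powersetCard.1 ht).2
  simp only [Function.comp_apply]
  rw [Multiset.prod_map_mul, Multiset.map_const', Multiset.prod_replicate, hcard, Multiset.map_id']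

/-! ### One-term decompositions are cuspidal exterior squares -/

section OneTerm

variable {F : Type} [Field F] [NumberField F]

/-- **A one-term isobaric decomposition is a cuspidal exterior square.** Let `P` be a weak
exterior square of `π` (`t_{P,v} = ∧² t_{π,v}` a.e., first clause of `Kim2003_exteriorSquare_GL4`)
and `σ` a cuspidal datum on `GL₆` with `t_{σ,v} = β ⇒ t_{P,v} = β` a.e. (the isobaric clause with
`k = 1`). If Satake parameters of `P` are unique (`hasSatakeParamAt_unique`, Flath) and `σ` has
Satake parameters a.e. (`hasSatakeParamAt_cofinite`), then `t_{σ,v} = ∧² t_{π,v}` for almost all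
`v`: the cuspidal `σ` IS `∧²π` in the a.e.-Satake sense. [folklore] -/
theorem Kim2003_exteriorSquare_GL4.hasSatakeParamAt_of_decomposition_one
    {h4 : isCompact_glFiniteIntegralLevel 4 F} {h6 : isCompact_glFiniteIntegralLevel 6 F}
    {π : CuspidalAutomorphicRepData 4 F h4} {P : AutomorphicRepData (AutomorphyDatum.gl 6 F h6)}
    {σ : CuspidalAutomorphicRepData 6 F h6}
    (huniq : P.hasSatakeParamAt_unique) (hcof : σ.1.hasSatakeParamAt_cofinite)
    (hP : ∀ᶠ v : HeightOneSpectrum (𝓞 F) in Filter.cofinite, ∀ α : Multiset ℂ,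
      π.1.HasSatakeParamAt v α → P.HasSatakeParamAt v (wedgeTwoParams α))
    (hdec : ∀ᶠ v : HeightOneSpectrum (𝓞 F) in Filter.cofinite, ∀ β : Multiset ℂ,
      σ.1.HasSatakeParamAt v β → P.HasSatakeParamAt v β) :
    ∀ᶠ v : HeightOneSpectrum (𝓞 F) in Filter.cofinite, ∀ α : Multiset ℂ,
      π.1.HasSatakeParamAt v α → σ.1.HasSatakeParamAt v (wedgeTwoParams α) := by
  filter_upwards [hP, hcof, hdec] with v hv₁ hv₂ hv₃ α hα
  obtain ⟨β, hβ⟩ := hv₂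
  have hβα : β = wedgeTwoParams α := huniq (hv₃ β hβ) (hv₁ α hα)
  exact hβα ▸ hβ

/-- The isobaric clause of `Kim2003_exteriorSquare_GL4` for a family indexed by `Fin 1` is the
one-term hypothesis `hdec` of `hasSatakeParamAt_of_decomposition_one` (bookkeeping:
`∑ i : Fin 1, β i = β 0`). [folklore] -/
theorem isobaricClause_one_iff {m : Fin 1 → ℕ} {hm : ∀ i, isCompact_glFiniteIntegralLevel (m i) F}
    {h6 : isCompact_glFiniteIntegralLevel 6 F}
    (σ : (i : Fin 1) → CuspidalAutomorphicRepData (m i) F (hm i))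
    (P : AutomorphicRepData (AutomorphyDatum.gl 6 F h6))
    (v : HeightOneSpectrum (𝓞 F)) :
    (∀ β : Fin 1 → Multiset ℂ, (∀ i, (σ i).1.HasSatakeParamAt v (β i)) →
        P.HasSatakeParamAt v (∑ i, β i)) ↔
      ∀ β : Multiset ℂ, (σ 0).1.HasSatakeParamAt v β → P.HasSatakeParamAt v β := by
  constructor
  · intro H β hβ
    simpa using H (fun _ ↦ β) (fun i ↦ by rwa [Fin.fin_one_eq_zero i])
  · intro H β hβ
    simpa using H (β 0) (hβ 0)

end OneTerm

end Literature.NumberTheory.Automorphic
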